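import Summits.QuantumFields.BalabanUV.T4Continuum.Support.NE9CurChartTower
import Literature.MathematicalPhysics.QuantumFieldTheory.Balaban1983to89.B9Eq319QprimeTowerCentre
import Summits.QuantumFields.BalabanUV.T4Continuum.Support.NE9CurChartTowerUniformBall

/-!
# NE9CurChartTowerClosed — THE `ε`-ONLY CHART OF `cur U` FOR PRINT's `k`-TH-STEP OPERATOR WITH THE RIGHT-INVERSE SECTIONS DISCHARGED
# (the row OWNER's `Support/NE9CurChartTower` §4 `cur_chart_exists_tower_of_small_bonds_unitary` minus its displayed `(S₁, S₂, CS)`, inhabited by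
# NE9 leaf-02's universal right inverse of the composite averaging `Q′_k`, `B9Eq319QprimeTowerCentre.exists_QprimeTowerW_rightInverse`); cell
# `pub-balaban`, T4-DAG §2 node U3 ∕ §6 NE9, route R2′ one storey up ([Balaban1985BackgroundPropagators] (3.15)∕(3.19) p. 393, Thm 3.11 p. 416;
# [Balaban1985Variational] (172)–(175) p. 305); Summits-side NEW sibling leaf under the OWNER's INTERFACE REQUEST (ruling e34b3e0c (0) —
# `t4/b2b-balaban-t4-ne9-p1/g83/TOWER-SPECIES-PLAN.md` §2 (a) «`cur_chart_exists_tower_of_small_bonds_unitary'` … a sibling `Support/NE9CurChartTowerClosed`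
# under an IFREQ … first refusal leaf-02», W-9 l.45055, W-10 l.45282 «STAYS WITH YOU: GO, THIS SHAPE»; IFREQ [NE9LEAF02-G63-IFREQ1] INBOX L.35522);
# nothing printed asserted

HONEST FRAMING (T4-DAG PAGE 1).  Rung (B)+1 of the FINITE-VOLUME T⁴ programme — NOT infinite volume, NOT a mass gap, NOT the Clay problem.  NE9
(`T4OutputRate.NE9` ∧ `FadingMemory`) is a cell NEW ESTIMATE, NOT PRINTED in [I] = [Balaban1987RG1] (CMP **109**), [II] = [Balaban1988RG2Cluster]
(CMP **116**), and NOT PROVED here («NE9 ⇐ the named binders»; spine PROVED 0∕9).  HONEST DEPENDENCY (cell line, verbatim): continuum YM on T⁴ ⇐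
BetaPertH ∧ nine spine estimates (0/9 proved); BetaPertH ⇐ (D1) ∧ (D4) ∧ CAP+tail; G-an2-4 gates asym, D1 and NE2/3/4.  The `cur U` OBJECT is ONE
item of the MODEL O-NE9-1 (species (a) data); the END's `act` ∕ `ker` halves and NEEDS-COORDINATOR #5 are untouched.

THE PRINT (loci only).  [Balaban1985BackgroundPropagators] p. 393 (3.15) «Q_j(U) = Q(Ū^{j−1})…Q(Ū)Q(U)», (3.19) the composite `Q′_j`; p. 416 Thm 3.11
«the operators Δ′_a, G′, (Q′G′²Q′*)⁻¹, Δ_a, G are positive definite»; print needs only «Q′ onto» — a bounded right inverse is this tree's device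
([folklore]; nearest print: Dimock, arXiv:1712.10029 p. 27, the abelian `QQ^{s,T} = I`).  [Balaban1985Variational] p. 305 (172)–(175): the chart of the
critical configuration.

WHAT THIS FILE PROVES (THREE theorems — §1 v1 + §2 APPEND v1.1; 0 def, 0 sorry, axioms standard; [folklore] composition BY NAME).  **`cur_chart_exists_tower_of_small_bonds_unitary'`**
= the host's §4 VERBATIM with the binders `(S₁ S₂ : (TSite d m → W) →ₗ[ℂ] SiteL2K ℂ d (towerP L m (n+1)) c₀ W)`, `(∀ f, Q′_k(1)(S₁ f) = f)`,
`(∀ f, Q′_k(U)(S₂ f) = f)`, `(∀ f, ‖S₁ f‖ ≤ CS‖f‖)`, `(∀ f, ‖S₂ f‖ ≤ CS‖f‖)` and the parameter `{CS} (hCS : 0 ≤ CS)` GONE: there is `ε₁ > 0` (a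
finite-lattice number — `CS := (L^d)^{n+1}·√(c₀·#T_m)` is fixed BEFORE `∃ ε₁` because leaf-02's section `S` is `φ`∕`U`-free) such that for EVERY `U`
with `U(b) ∈ U1`, `U(b)* = U(b)⁻¹`, `‖U(b) − 1‖ ≤ ε ≤ ε₁`, `Ũ ∈ G` (averaging-closed gauge group, `Cck`'s numerics `α₀`∕`ρ`) and every admissible
(L3)-slot `Wq`: `∃ h52 ∃ hpos` and the triple (Ψ1)–(Ψ3).  Displayed background letters left: `ε`, `G` with `α₀`∕`ρ`, the slot `Wq`.  Proof = five lines: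
`obtain ⟨S, hS, -, hSn⟩ := exists_QprimeTowerW_rightInverse L m n`, `hCS` by `positivity`, the host's §4 at `hCS`, `S₁ = S₂ := S`.
§2 (APPEND v1.1, the OWNER's W-16 «likewise later for INTENT-9's two theorems … a sibling or your (B) host»): **`cur_chart_exists_tower_of_small_field_unitary_uniform'`**,
**`cur_chart_exists_tower_of_small_bonds_unitary_uniform'`** = the OWNER's `Support/NE9CurChartTowerUniformBall` §1∕§2 (the k-level UNIFORM BALL: radii
`ε₄ ε_C R_b R′` BEFORE `∀ U`) VERBATIM minus the same right-inverse binders, inhabited the same way (five proof lines each).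
DISGUISE TEST: composition of two landed theorems; no inequality of the series proved; per-LATTICE, per-HEIGHT numbers (exponential in `k`; `CS`
carries the coarse volume `√#T_m` — PRICING v58 light note) — NOT print's lattice-uniform Thm 3.3∕3.12∕3.13, NOT the two-background chart, not NE9.
Imports the host `Support/NE9CurChartTower` (the OWNER, IFREQ #4), `B9Eq319QprimeTowerCentre` (this lineage; cone `B9Eq326OperatorTower` ⊂ the
host's) and (v1.1) the OWNER's `Support/NE9CurChartTowerUniformBall` (IFREQ #5; it imports the host, NOT this sibling — no cycle) ONLY; modifies nothing; no END re-wired.  Unit `b2b-balaban-t4-ne9-formalise-leaf-02` (NE9 crux-team leaf prover, gen 63).  Value = route R2′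
bookkeeping at rung (B)+1 (one displayed binder of the k-level species face discharged), NOT summit progress.
-/

noncomputable section

open Metric Set

namespace Summit.QuantumFields.BalabanUV.T4Continuum.NE9CurChartTowerClosed

open scoped InnerProductSpace
open Literature.MathematicalPhysics.QuantumFieldTheory.Balaban1983to89
open B11Eq103H1Complex B11Eq115Space B11Eq174Chart
open B11Eq111FrakG (nabla115)
open B13Contraction113 (QuadAnalytic)
open B9SectCLatticeCarrier (Bond)
open B4Sect5Torus (TSite)
open B7Prop1Explicit (U1 Wcx boxVec)
open B7Prop2Explicit (pdev AvgClosed C0 c2')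
open B7Prop3Flat (c3)
open B9Eq315QTorus (perCfg cornerSite)
open B9Eq315QTower (towerP UlevOf)
open B9Eq326OperatorTower (QprimeTowerW QkW QkW_surjective laplaceAk)
open B9Eq310HessianOperator (adTransportW)
open B11Eq44COperatorTower (C2T C2T_nonneg αT αT_le ulev_mem_U1_of_pdev ulev_reg_of_pdev)
open B11Eq44CLetterTower (Cck)
open B9Eq319QprimeTowerCentre (exists_QprimeTowerW_rightInverse)
open Summit.QuantumFields.BalabanUV.T4Continuum.NE9CurChartTower (cur_chart_exists_tower_of_small_bonds_unitary)

/-- **THE `ε`-ONLY CHART OF `cur U` FOR PRINT's `k`-TH-STEP OPERATOR, SECTIONS DISCHARGED** — the host's §4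
`NE9CurChartTower.cur_chart_exists_tower_of_small_bonds_unitary` with the right inverses `S₁`∕`S₂` of `Q′_k(1)`∕`Q′_k(U)` and their bound `CS` inhabited by
NE9 leaf-02's universal section (`exists_QprimeTowerW_rightInverse`: one linear `S`, `Q′_k(U) ∘ S = id` for every `φ`, `U`; `S₁ = S₂ = S`,
`CS := (L^d)^{n+1}·√(c₀·#T_m)` fixed before `∃ ε₁`).  Background binders left: `Ũ ∈ G`, `U(b) ∈ U1`, `‖U(b) − 1‖ ≤ ε ≤ ε₁`, `U(b)* = U(b)⁻¹`, the slot `Wq`.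
[folklore composition BY NAME] [cite: Balaban1985BackgroundPropagators, (3.15)/(3.19) p.393, Thm 3.11 p.416; Balaban1985Variational, (172)–(175) p.305] -/
theorem cur_chart_exists_tower_of_small_bonds_unitary' {d : ℕ} (L : ℕ) [NeZero L] (m : Fin d → ℕ) [∀ i, NeZero (m i)] (n : ℕ) (hL : 1 ≤ L)
    (hL2 : 2 ≤ L)
    {𝔸 : Type*} [NormedRing 𝔸] [NormedAlgebra ℂ 𝔸] [CompleteSpace 𝔸] [NormOneClass 𝔸] [StarRing 𝔸] [NormedStarGroup 𝔸] [StarModule ℂ 𝔸]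
    [FiniteDimensional ℂ 𝔸]
    {W : Type*} [NormedAddCommGroup W] [InnerProductSpace ℂ W] [FiniteDimensional ℂ W] (φ : W ≃ₗ[ℂ] 𝔸) {Mφ Mφ' : ℝ} (hMφ : 0 ≤ Mφ)
    (hMφ' : 0 ≤ Mφ') (hφ : ∀ w, ‖φ w‖ ≤ Mφ * ‖w‖) (hφ' : ∀ X, ‖φ.symm X‖ ≤ Mφ' * ‖X‖)
    (τ : 𝔸 →ₗ[ℂ] ℂ) {Cτ : ℝ} (hτ : ∀ X, ‖τ X‖ ≤ Cτ * ‖X‖) (hCτ : 0 ≤ Cτ)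
    (hτφ : ∀ X Y : 𝔸, inner ℂ (φ.symm X) (φ.symm Y) = τ (star X * Y)) (htr : ∀ X Y : 𝔸, τ (X * Y) = τ (Y * X))
    {η : ℝ} (hη : η ≠ 0) [Fact (0 < (L : ℝ))] [Fact (0 < η)] {lev₀ : Bond d (towerP L m (n + 1)) → ℕ} {levB : Bond d m → ℕ}
    (lev₁ : Bond d (towerP L m (n + 1)) × Fin d → ℕ)
    {G : Subgroup 𝔸ˣ} (hG : AvgClosed d L G) {α₀ : ℝ} (hα₀ : 0 < α₀) (hα3 : C0 d * α₀ ≤ 1 / 3) (hα4 : 4 * α₀ ≤ c2' d L)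
    (hαL : 50 * (d + 1) * αT d L α₀ * (L : ℝ) ^ d ≤ 1 / 2) (hlev : ∀ b, n + 1 ≤ lev₀ b)
    {ρ : ℝ} (hρ0 : 0 < ρ) (hρ : Real.exp (4 * (800 * ((d : ℝ) + 1) ^ 2 * ((d : ℝ) + 4)) * α₀) * (1 + 8 * (131072 * ((d : ℝ) + 1) ^ 2) * ρ) ≤ 2)
    (hρc : 2 * ρ ≤ c3 d L) {c₀ c₁ : ℝ} [Fact (0 < c₀)] [Fact (0 < c₁)] {a : ℝ} (ha : 0 < a) :
    ∃ ε₁ : ℝ, 0 < ε₁ ∧ ∀ (U : Bond d (towerP L m (n + 1)) → 𝔸ˣ)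
      (hUG : ∀ (x : B7Prop1Explicit.Site d) (κ : Fin d), perCfg (towerP L m (n + 1)) U x κ ∈ G)
      {ε : ℝ}, 0 ≤ ε → ε ≤ ε₁ →
      (∀ b, U b ∈ U1 𝔸) → (∀ b, ‖(U b : 𝔸) - 1‖ ≤ ε) → (∀ b, star (U b : 𝔸) = (((U b)⁻¹ : 𝔸ˣ) : 𝔸)) →
      ∀ {Wq : Space115 (L : ℝ) η lev₀ lev₁ (nabla115 η U) → NegSize (L : ℝ) η lev₀ 3 𝔸} {C₄ a₃ : ℝ}, QuadAnalytic Wq C₄ a₃ → 0 ≤ C₄ → 0 < a₃ →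
        AnalyticOnNhd ℂ Wq {Y | ‖Y‖ < a₃} →
      ∃ h52 : pdev (perCfg (towerP L m (n + 1)) U) < α₀ * (((L : ℝ) ^ (n + 1))⁻¹) ^ 2,
      ∃ hpos : ∀ x : BondL2K ℂ d (towerP L m (n + 1)) c₀ W, x ≠ 0 →
          0 < RCLike.re (inner ℂ x (laplaceAk L m n φ η U hL (fun _ => αT d L α₀) (fun _ => αT_le hL hα4)
            (ulev_mem_U1_of_pdev L m (n + 1) U hL2 hG hUG hα₀ hα3 hα4 h52) (ulev_reg_of_pdev L m (n + 1) U hL2 hG hUG hα₀ hα3 hα4 h52) τ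
            (c₀ := c₀) (c₁ := c₁) a x)),
      ∃ ε₄ εC Rb R' : ℝ, 0 < Rb ∧ 0 < R' ∧
        DifferentiableOn ℂ (chartHB (frakGLatticeCLM (lev₀ := lev₀) φ hpos (QkW_surjective L m n φ U hL _ _ _ _ fun _ => hαL) lev₁ (nabla115 η U))
            0 Wq 0 (fun A' => A' + solA (H1LatticeCLM (lev₀ := lev₀) (levB := levB) φ hpos (QkW_surjective L m n φ U hL _ _ _ _ fun _ => hαL) lev₁
              (nabla115 η U)) 0 (Cck L m η (n + 1) U lev₀ lev₁ (nabla115 η U) levB) 0 εC A') ε₄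
            (H1LatticeCLM (lev₀ := lev₀) (levB := levB) φ hpos (QkW_surjective L m n φ U hL _ _ _ _ fun _ => hαL) lev₁ (nabla115 η U)))
          (ball (0 : NegSize (L : ℝ) η levB 0 𝔸) Rb) ∧
        MapsTo (chartHB (frakGLatticeCLM (lev₀ := lev₀) φ hpos (QkW_surjective L m n φ U hL _ _ _ _ fun _ => hαL) lev₁ (nabla115 η U))
            0 Wq 0 (fun A' => A' + solA (H1LatticeCLM (lev₀ := lev₀) (levB := levB) φ hpos (QkW_surjective L m n φ U hL _ _ _ _ fun _ => hαL) lev₁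
              (nabla115 η U)) 0 (Cck L m η (n + 1) U lev₀ lev₁ (nabla115 η U) levB) 0 εC A') ε₄
            (H1LatticeCLM (lev₀ := lev₀) (levB := levB) φ hpos (QkW_surjective L m n φ U hL _ _ _ _ fun _ => hαL) lev₁ (nabla115 η U)))
          (ball (0 : NegSize (L : ℝ) η levB 0 𝔸) Rb) (ball (0 : Space115 (L : ℝ) η lev₀ lev₁ (nabla115 η U)) R') ∧
        chartHB (frakGLatticeCLM (lev₀ := lev₀) φ hpos (QkW_surjective L m n φ U hL _ _ _ _ fun _ => hαL) lev₁ (nabla115 η U))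
            0 Wq 0 (fun A' => A' + solA (H1LatticeCLM (lev₀ := lev₀) (levB := levB) φ hpos (QkW_surjective L m n φ U hL _ _ _ _ fun _ => hαL) lev₁
              (nabla115 η U)) 0 (Cck L m η (n + 1) U lev₀ lev₁ (nabla115 η U) levB) 0 εC A') ε₄
            (H1LatticeCLM (lev₀ := lev₀) (levB := levB) φ hpos (QkW_surjective L m n φ U hL _ _ _ _ fun _ => hαL) lev₁ (nabla115 η U)) 0 = 0 := by
  obtain ⟨S, hS, -, hSn⟩ := exists_QprimeTowerW_rightInverse L m n (𝔸 := 𝔸) (W := W) (c₀ := c₀)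
  have hCS : (0 : ℝ) ≤ ((L : ℝ) ^ d) ^ (n + 1) * Real.sqrt (c₀ * Fintype.card (TSite d m)) := by positivity
  obtain ⟨ε₁, hε₁, H⟩ := cur_chart_exists_tower_of_small_bonds_unitary L m n hL hL2 φ (c₀ := c₀) (c₁ := c₁) (lev₀ := lev₀) (levB := levB)
    hMφ hMφ' hφ hφ' τ hτ hCτ hτφ htr hη lev₁ hG hα₀ hα3 hα4 hαL hlev hρ0 hρ hρc ha hCS
  refine ⟨ε₁, hε₁, ?_⟩
  intro U hUG ε hε hεle hUb hUε hUstar Wq C₄ a₃ hW hC₄ ha₃ hWa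
  exact H U hUG S S hε hεle hUb hUε hUstar (hS φ _) (hS φ U) hSn hSn hW hC₄ ha₃ hWa


/-! ## §2 The k-level UNIFORM BALL with the sections discharged (APPEND v1.1, NE9 leaf-02 gen 63; the OWNER's W-16 «likewise for INTENT-9's two theorems … your (B) host») -/

section UniformBallSectionsFree

open B9Eq315QTowerFlat (perCfg_UlevOf_one_mem_U1 norm_Wcx_UlevOf_one_sub_one_le)
open Summit.QuantumFields.BalabanUV.T4Continuum.NE9CurChartTowerUniformBall
  (cur_chart_exists_tower_of_small_field_unitary_uniform cur_chart_exists_tower_of_small_bonds_unitary_uniform)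

/-- **THE k-LEVEL UNIFORM BALL AT EVERY SMALL FIELD, SECTIONS DISCHARGED** — the OWNER's
`NE9CurChartTowerUniformBall.cur_chart_exists_tower_of_small_field_unitary_uniform` (radii `ε₄ εC Rb R′` BEFORE `∀ U`) with the right-inverse binders
`(S₁ S₂ …) hS₁ hS₂ hS₁n hS₂n` and the parameter `CS` inhabited by `B9Eq319QprimeTowerCentre.exists_QprimeTowerW_rightInverse` (`S₁ = S₂ = S`,
`CS := (L^d)^{n+1}·√(c₀·#T_m)` fixed before `∃ ε₀`).  Displays left: the tower data `α`, the letters `ρ′`, `δ_Q`, `Ũ ∈ G`, (52), the slot `Wq`.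
[folklore composition BY NAME] [cite: Balaban1985BackgroundPropagators, (3.15)/(3.19) p.393, Thm 3.11 p.416, (3.126) p.420; Balaban1985Variational, (117)–(118) p.295, (172)–(175) p.305] -/
theorem cur_chart_exists_tower_of_small_field_unitary_uniform' {d : ℕ} (L : ℕ) [NeZero L] (m : Fin d → ℕ) [∀ i, NeZero (m i)] (n : ℕ) (hL : 1 ≤ L)
    (hL2 : 2 ≤ L)
    {𝔸 : Type*} [NormedRing 𝔸] [NormedAlgebra ℂ 𝔸] [CompleteSpace 𝔸] [NormOneClass 𝔸] [StarRing 𝔸] [NormedStarGroup 𝔸] [StarModule ℂ 𝔸]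
    [FiniteDimensional ℂ 𝔸]
    {W : Type*} [NormedAddCommGroup W] [InnerProductSpace ℂ W] [FiniteDimensional ℂ W] (φ : W ≃ₗ[ℂ] 𝔸) {Mφ Mφ' : ℝ} (hMφ : 0 ≤ Mφ)
    (hMφ' : 0 ≤ Mφ') (hφ : ∀ w, ‖φ w‖ ≤ Mφ * ‖w‖) (hφ' : ∀ X, ‖φ.symm X‖ ≤ Mφ' * ‖X‖)
    (τ : 𝔸 →ₗ[ℂ] ℂ) {Cτ : ℝ} (hτ : ∀ X, ‖τ X‖ ≤ Cτ * ‖X‖) (hCτ : 0 ≤ Cτ)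
    (hτφ : ∀ X Y : 𝔸, inner ℂ (φ.symm X) (φ.symm Y) = τ (star X * Y)) (htr : ∀ X Y : 𝔸, τ (X * Y) = τ (Y * X))
    {η : ℝ} (hη : η ≠ 0) [Fact (0 < (L : ℝ))] [Fact (0 < η)] {lev₀ : Bond d (towerP L m (n + 1)) → ℕ} {levB : Bond d m → ℕ}
    (lev₁ : Bond d (towerP L m (n + 1)) × Fin d → ℕ) (α : ℕ → ℝ) (hα1 : ∀ j, α j ≤ 1 / 64) (hαL : ∀ j, 50 * (d + 1) * α j * (L : ℝ) ^ d ≤ 1 / 2)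
    {G : Subgroup 𝔸ˣ} (hG : AvgClosed d L G) {α₀ : ℝ} (hα₀ : 0 < α₀) (hα3 : C0 d * α₀ ≤ 1 / 3) (hα4 : 4 * α₀ ≤ c2' d L) (hlev : ∀ b, n + 1 ≤ lev₀ b)
    {ρ : ℝ} (hρ0 : 0 < ρ) (hρ : Real.exp (4 * (800 * ((d : ℝ) + 1) ^ 2 * ((d : ℝ) + 4)) * α₀) * (1 + 8 * (131072 * ((d : ℝ) + 1) ^ 2) * ρ) ≤ 2)
    (hρc : 2 * ρ ≤ c3 d L) {c₀ c₁ : ℝ} [Fact (0 < c₀)] [Fact (0 < c₁)] {a : ℝ} (ha : 0 < a)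
    {C₄ a₃ : ℝ} (hC₄ : 0 ≤ C₄) (ha₃ : 0 < a₃) :
    ∃ ε₀ ε₄ εC Rb R' : ℝ, 0 < ε₀ ∧ 0 < Rb ∧ 0 < R' ∧ ∀ (U : Bond d (towerP L m (n + 1)) → 𝔸ˣ)
      (hU1 : ∀ (j : ℕ) (x : B7Prop1Explicit.Site d) (κ : Fin d), perCfg (towerP L m (j + 1)) (UlevOf L m (n + 1) U j) x κ ∈ U1 𝔸)
      (hreg : ∀ (j : ℕ) (y : TSite d (towerP L m j)) (κ : Fin d) (r : Fin d → Fin L),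
        ‖((Wcx L (perCfg (towerP L m (j + 1)) (UlevOf L m (n + 1) U j)) (cornerSite L y) κ (boxVec L r) : 𝔸ˣ) : 𝔸) - 1‖ ≤ α j)
      {ε ρ' δQ : ℝ}, 0 ≤ ε → 0 ≤ ρ' → 0 ≤ δQ → ε + ρ' + δQ ≤ ε₀ →
      (∀ b, U b ∈ U1 𝔸) → (∀ b, ‖(U b : 𝔸) - 1‖ ≤ ε) → (∀ b, star (U b : 𝔸) = (((U b)⁻¹ : 𝔸ˣ) : 𝔸)) →
      (∀ l : SiteL2K ℂ d (towerP L m (n + 1)) c₀ W,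
        ‖QprimeTowerW L m n φ U l - QprimeTowerW L m n φ (fun _ : Bond d (towerP L m (n + 1)) => (1 : 𝔸ˣ)) l‖ ≤ ρ' * ‖l‖) →
      (∀ x : BondL2K ℂ d (towerP L m (n + 1)) c₀ W, ‖QkW L m n φ U hL α hα1 hU1 hreg (c₁ := c₁) x -
        QkW L m n φ (fun _ : Bond d (towerP L m (n + 1)) => (1 : 𝔸ˣ)) hL (fun _ => 0) (fun _ => by norm_num)
          (perCfg_UlevOf_one_mem_U1 L m (n + 1)) (norm_Wcx_UlevOf_one_sub_one_le L m (n + 1) (fun _ => 0) (fun _ => le_rfl)) (c₁ := c₁) x‖ ≤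
        δQ * ‖x‖) →
      (∀ (x : B7Prop1Explicit.Site d) (κ : Fin d), perCfg (towerP L m (n + 1)) U x κ ∈ G) →
      pdev (perCfg (towerP L m (n + 1)) U) < α₀ * (((L : ℝ) ^ (n + 1))⁻¹) ^ 2 →
      ∀ {Wq : Space115 (L : ℝ) η lev₀ lev₁ (nabla115 η U) → NegSize (L : ℝ) η lev₀ 3 𝔸}, QuadAnalytic Wq C₄ a₃ →
        AnalyticOnNhd ℂ Wq {Y | ‖Y‖ < a₃} →
      ∃ hpos : ∀ x : BondL2K ℂ d (towerP L m (n + 1)) c₀ W, x ≠ 0 →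
          0 < RCLike.re (inner ℂ x (laplaceAk L m n φ η U hL α hα1 hU1 hreg τ (c₀ := c₀) (c₁ := c₁) a x)),
        DifferentiableOn ℂ (chartHB (frakGLatticeCLM (lev₀ := lev₀) φ hpos (QkW_surjective L m n φ U hL α hα1 hU1 hreg hαL) lev₁ (nabla115 η U))
            0 Wq 0 (fun A' => A' + solA (H1LatticeCLM (lev₀ := lev₀) (levB := levB) φ hpos (QkW_surjective L m n φ U hL α hα1 hU1 hreg hαL) lev₁
              (nabla115 η U)) 0 (Cck L m η (n + 1) U lev₀ lev₁ (nabla115 η U) levB) 0 εC A') ε₄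
            (H1LatticeCLM (lev₀ := lev₀) (levB := levB) φ hpos (QkW_surjective L m n φ U hL α hα1 hU1 hreg hαL) lev₁ (nabla115 η U)))
          (ball (0 : NegSize (L : ℝ) η levB 0 𝔸) Rb) ∧
        MapsTo (chartHB (frakGLatticeCLM (lev₀ := lev₀) φ hpos (QkW_surjective L m n φ U hL α hα1 hU1 hreg hαL) lev₁ (nabla115 η U))
            0 Wq 0 (fun A' => A' + solA (H1LatticeCLM (lev₀ := lev₀) (levB := levB) φ hpos (QkW_surjective L m n φ U hL α hα1 hU1 hreg hαL) lev₁
              (nabla115 η U)) 0 (Cck L m η (n + 1) U lev₀ lev₁ (nabla115 η U) levB) 0 εC A') ε₄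
            (H1LatticeCLM (lev₀ := lev₀) (levB := levB) φ hpos (QkW_surjective L m n φ U hL α hα1 hU1 hreg hαL) lev₁ (nabla115 η U)))
          (ball (0 : NegSize (L : ℝ) η levB 0 𝔸) Rb) (ball (0 : Space115 (L : ℝ) η lev₀ lev₁ (nabla115 η U)) R') ∧
        chartHB (frakGLatticeCLM (lev₀ := lev₀) φ hpos (QkW_surjective L m n φ U hL α hα1 hU1 hreg hαL) lev₁ (nabla115 η U))
            0 Wq 0 (fun A' => A' + solA (H1LatticeCLM (lev₀ := lev₀) (levB := levB) φ hpos (QkW_surjective L m n φ U hL α hα1 hU1 hreg hαL) lev₁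
              (nabla115 η U)) 0 (Cck L m η (n + 1) U lev₀ lev₁ (nabla115 η U) levB) 0 εC A') ε₄
            (H1LatticeCLM (lev₀ := lev₀) (levB := levB) φ hpos (QkW_surjective L m n φ U hL α hα1 hU1 hreg hαL) lev₁ (nabla115 η U)) 0 = 0 := by
  obtain ⟨S, hS, -, hSn⟩ := exists_QprimeTowerW_rightInverse L m n (𝔸 := 𝔸) (W := W) (c₀ := c₀)
  have hCS : (0 : ℝ) ≤ ((L : ℝ) ^ d) ^ (n + 1) * Real.sqrt (c₀ * Fintype.card (TSite d m)) := by positivity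
  obtain ⟨ε₀, ε₄, εC, Rb, R', hε₀, hRb0, hR'0, H⟩ := cur_chart_exists_tower_of_small_field_unitary_uniform L m n hL hL2 φ (c₀ := c₀)
    (c₁ := c₁) (lev₀ := lev₀) (levB := levB) hMφ hMφ' hφ hφ' τ hτ hCτ hτφ htr hη lev₁ α hα1 hαL hG hα₀ hα3 hα4 hlev hρ0 hρ hρc ha hCS hC₄ ha₃
  refine ⟨ε₀, ε₄, εC, Rb, R', hε₀, hRb0, hR'0, ?_⟩
  intro U hU1 hreg ε ρ' δQ hε hρ' hδQ ht hUb hUε hUstar hQ' hQd hUG h52 Wq hW hWa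
  exact H U hU1 hreg S S hε hρ' hδQ ht hUb hUε hUstar (hS φ _) (hS φ U) hSn hSn hQ' hQd hUG h52 hW hWa

/-- **THE k-LEVEL UNIFORM BALL IN THE `ε`-ONLY FORM, SECTIONS DISCHARGED** — the OWNER's
`NE9CurChartTowerUniformBall.cur_chart_exists_tower_of_small_bonds_unitary_uniform` with `(S₁ S₂ …) hS₁ hS₂ hS₁n hS₂n` and `CS` inhabited the same
way: for every slot bound `(C₄, a₃)` there are `ε₁ > 0` and radii `ε₄ εC Rb R′` BEFORE `∀ U` such that at every unit-bounded unitary `ε`-small `U`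
with `Ũ ∈ G` and every admissible `Wq`: `∃ h52 ∃ hpos` and the triple (Ψ1)–(Ψ3).  Displays left: `ε`, `G` with `α₀`∕`ρ`, the slot `Wq`.
[folklore composition BY NAME] [cite: Balaban1985BackgroundPropagators, (3.15)/(3.19) p.393, Thm 3.11 p.416; Balaban1985Variational, (117)–(118) p.295, (172)–(175) p.305; Balaban1985Averaging, (43) p.24] -/
theorem cur_chart_exists_tower_of_small_bonds_unitary_uniform' {d : ℕ} (L : ℕ) [NeZero L] (m : Fin d → ℕ) [∀ i, NeZero (m i)] (n : ℕ) (hL : 1 ≤ L)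
    (hL2 : 2 ≤ L)
    {𝔸 : Type*} [NormedRing 𝔸] [NormedAlgebra ℂ 𝔸] [CompleteSpace 𝔸] [NormOneClass 𝔸] [StarRing 𝔸] [NormedStarGroup 𝔸] [StarModule ℂ 𝔸]
    [FiniteDimensional ℂ 𝔸]
    {W : Type*} [NormedAddCommGroup W] [InnerProductSpace ℂ W] [FiniteDimensional ℂ W] (φ : W ≃ₗ[ℂ] 𝔸) {Mφ Mφ' : ℝ} (hMφ : 0 ≤ Mφ)
    (hMφ' : 0 ≤ Mφ') (hφ : ∀ w, ‖φ w‖ ≤ Mφ * ‖w‖) (hφ' : ∀ X, ‖φ.symm X‖ ≤ Mφ' * ‖X‖)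
    (τ : 𝔸 →ₗ[ℂ] ℂ) {Cτ : ℝ} (hτ : ∀ X, ‖τ X‖ ≤ Cτ * ‖X‖) (hCτ : 0 ≤ Cτ)
    (hτφ : ∀ X Y : 𝔸, inner ℂ (φ.symm X) (φ.symm Y) = τ (star X * Y)) (htr : ∀ X Y : 𝔸, τ (X * Y) = τ (Y * X))
    {η : ℝ} (hη : η ≠ 0) [Fact (0 < (L : ℝ))] [Fact (0 < η)] {lev₀ : Bond d (towerP L m (n + 1)) → ℕ} {levB : Bond d m → ℕ}
    (lev₁ : Bond d (towerP L m (n + 1)) × Fin d → ℕ)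
    {G : Subgroup 𝔸ˣ} (hG : AvgClosed d L G) {α₀ : ℝ} (hα₀ : 0 < α₀) (hα3 : C0 d * α₀ ≤ 1 / 3) (hα4 : 4 * α₀ ≤ c2' d L)
    (hαL : 50 * (d + 1) * αT d L α₀ * (L : ℝ) ^ d ≤ 1 / 2) (hlev : ∀ b, n + 1 ≤ lev₀ b)
    {ρ : ℝ} (hρ0 : 0 < ρ) (hρ : Real.exp (4 * (800 * ((d : ℝ) + 1) ^ 2 * ((d : ℝ) + 4)) * α₀) * (1 + 8 * (131072 * ((d : ℝ) + 1) ^ 2) * ρ) ≤ 2)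
    (hρc : 2 * ρ ≤ c3 d L) {c₀ c₁ : ℝ} [Fact (0 < c₀)] [Fact (0 < c₁)] {a : ℝ} (ha : 0 < a)
    {C₄ a₃ : ℝ} (hC₄ : 0 ≤ C₄) (ha₃ : 0 < a₃) :
    ∃ ε₁ ε₄ εC Rb R' : ℝ, 0 < ε₁ ∧ 0 < Rb ∧ 0 < R' ∧ ∀ (U : Bond d (towerP L m (n + 1)) → 𝔸ˣ)
      (hUG : ∀ (x : B7Prop1Explicit.Site d) (κ : Fin d), perCfg (towerP L m (n + 1)) U x κ ∈ G)
      {ε : ℝ}, 0 ≤ ε → ε ≤ ε₁ →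
      (∀ b, U b ∈ U1 𝔸) → (∀ b, ‖(U b : 𝔸) - 1‖ ≤ ε) → (∀ b, star (U b : 𝔸) = (((U b)⁻¹ : 𝔸ˣ) : 𝔸)) →
      ∀ {Wq : Space115 (L : ℝ) η lev₀ lev₁ (nabla115 η U) → NegSize (L : ℝ) η lev₀ 3 𝔸}, QuadAnalytic Wq C₄ a₃ →
        AnalyticOnNhd ℂ Wq {Y | ‖Y‖ < a₃} →
      ∃ h52 : pdev (perCfg (towerP L m (n + 1)) U) < α₀ * (((L : ℝ) ^ (n + 1))⁻¹) ^ 2,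
      ∃ hpos : ∀ x : BondL2K ℂ d (towerP L m (n + 1)) c₀ W, x ≠ 0 →
          0 < RCLike.re (inner ℂ x (laplaceAk L m n φ η U hL (fun _ => αT d L α₀) (fun _ => αT_le hL hα4)
            (ulev_mem_U1_of_pdev L m (n + 1) U hL2 hG hUG hα₀ hα3 hα4 h52) (ulev_reg_of_pdev L m (n + 1) U hL2 hG hUG hα₀ hα3 hα4 h52) τ
            (c₀ := c₀) (c₁ := c₁) a x)),
        DifferentiableOn ℂ (chartHB (frakGLatticeCLM (lev₀ := lev₀) φ hpos (QkW_surjective L m n φ U hL _ _ _ _ fun _ => hαL) lev₁ (nabla115 η U))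
            0 Wq 0 (fun A' => A' + solA (H1LatticeCLM (lev₀ := lev₀) (levB := levB) φ hpos (QkW_surjective L m n φ U hL _ _ _ _ fun _ => hαL) lev₁
              (nabla115 η U)) 0 (Cck L m η (n + 1) U lev₀ lev₁ (nabla115 η U) levB) 0 εC A') ε₄
            (H1LatticeCLM (lev₀ := lev₀) (levB := levB) φ hpos (QkW_surjective L m n φ U hL _ _ _ _ fun _ => hαL) lev₁ (nabla115 η U)))
          (ball (0 : NegSize (L : ℝ) η levB 0 𝔸) Rb) ∧
        MapsTo (chartHB (frakGLatticeCLM (lev₀ := lev₀) φ hpos (QkW_surjective L m n φ U hL _ _ _ _ fun _ => hαL) lev₁ (nabla115 η U))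
            0 Wq 0 (fun A' => A' + solA (H1LatticeCLM (lev₀ := lev₀) (levB := levB) φ hpos (QkW_surjective L m n φ U hL _ _ _ _ fun _ => hαL) lev₁
              (nabla115 η U)) 0 (Cck L m η (n + 1) U lev₀ lev₁ (nabla115 η U) levB) 0 εC A') ε₄
            (H1LatticeCLM (lev₀ := lev₀) (levB := levB) φ hpos (QkW_surjective L m n φ U hL _ _ _ _ fun _ => hαL) lev₁ (nabla115 η U)))
          (ball (0 : NegSize (L : ℝ) η levB 0 𝔸) Rb) (ball (0 : Space115 (L : ℝ) η lev₀ lev₁ (nabla115 η U)) R') ∧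
        chartHB (frakGLatticeCLM (lev₀ := lev₀) φ hpos (QkW_surjective L m n φ U hL _ _ _ _ fun _ => hαL) lev₁ (nabla115 η U))
            0 Wq 0 (fun A' => A' + solA (H1LatticeCLM (lev₀ := lev₀) (levB := levB) φ hpos (QkW_surjective L m n φ U hL _ _ _ _ fun _ => hαL) lev₁
              (nabla115 η U)) 0 (Cck L m η (n + 1) U lev₀ lev₁ (nabla115 η U) levB) 0 εC A') ε₄
            (H1LatticeCLM (lev₀ := lev₀) (levB := levB) φ hpos (QkW_surjective L m n φ U hL _ _ _ _ fun _ => hαL) lev₁ (nabla115 η U)) 0 = 0 := by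
  obtain ⟨S, hS, -, hSn⟩ := exists_QprimeTowerW_rightInverse L m n (𝔸 := 𝔸) (W := W) (c₀ := c₀)
  have hCS : (0 : ℝ) ≤ ((L : ℝ) ^ d) ^ (n + 1) * Real.sqrt (c₀ * Fintype.card (TSite d m)) := by positivity
  obtain ⟨ε₁, ε₄, εC, Rb, R', hε₁, hRb0, hR'0, H⟩ := cur_chart_exists_tower_of_small_bonds_unitary_uniform L m n hL hL2 φ (c₀ := c₀)
    (c₁ := c₁) (lev₀ := lev₀) (levB := levB) hMφ hMφ' hφ hφ' τ hτ hCτ hτφ htr hη lev₁ hG hα₀ hα3 hα4 hαL hlev hρ0 hρ hρc ha hCS hC₄ ha₃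
  refine ⟨ε₁, ε₄, εC, Rb, R', hε₁, hRb0, hR'0, ?_⟩
  intro U hUG ε hε hε₁' hUb hUε hUstar Wq hW hWa
  exact H U hUG S S hε hε₁' hUb hUε hUstar (hS φ _) (hS φ U) hSn hSn hW hWa

end UniformBallSectionsFree

end Summit.QuantumFields.BalabanUV.T4Continuum.NE9CurChartTowerClosed

end
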